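import Summits.Ventures.HodgeRepro2.T5SphericalMultiplicityOneGLn
import Summits.Ventures.HodgeRepro2.T5CartanUniformiser

/-!
# The concrete instance: `GL_n(ℚ_p)` with `K = GL_n(ℤ_p)`

Tier-5 kernel support (blind cell pub-hodge-repro2, seat p8, gen 11). The chain T5-99 … T5-109
is stated for an abstract discrete valuation ring `R` with finite residue field and its fraction
field `F`. Mathlib's `ℤ_[p] ⊂ ℚ_[p]` is such a pair (`IsDiscreteValuationRing ℤ_[p]`,
`IsFractionRing ℤ_[p] ℚ_[p]`, residue field `ZMod p` through `PadicInt.residueField`), so every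
statement of the chain holds for `GL_n(ℚ_p)` and `K = GL_n(ℤ_p)` with NO hypothesis at all —
the non-vacuity witness of the whole chain (the referees' protocol §10.5(ii)(c)).

* `finite_residueField_padicInt` — `IsLocalRing.ResidueField ℤ_[p]` is finite;
* `exists_cartan_p` — the Cartan decomposition `GL_n(ℚ_p) = ⋃_a K · diag(p^{a_i}) · K`;
* `heckeAlgebra_mul_comm` — **`H(GL_n(ℚ_p), GL_n(ℤ_p))` is commutative**;
* `finrank_invariants_eq_one` — spherical multiplicity one for `GL_n(ℚ_p)`.

Hypotheses as stated in the kernel: `p` a prime (`Fact p.Prime`); `ι` a finite type with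
decidable equality; for the multiplicity-one statement `k` algebraically closed of characteristic
`0` and `ρ` irreducible, `K`-finite, with `ρ^K ≠ ⊥` finite-dimensional.
-/

namespace Summit.Ventures.HodgeRepro2.T5PadicHeckeCommutative

open Matrix

variable (p : ℕ) [Fact p.Prime] {ι : Type*} [Fintype ι] [DecidableEq ι]

/-- The residue field of `ℤ_[p]` is finite (it is `ZMod p`). -/
theorem finite_residueField_padicInt : Finite (IsLocalRing.ResidueField ℤ_[p]) :=
  Finite.of_equiv (ZMod p) (PadicInt.residueField (p := p)).symm.toEquiv

/-- The Cartan decomposition of `GL_n(ℚ_p)`: `g = k₁ · diag(p^{m_1}, …, p^{m_n}) · k₂` with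
`k₁, k₂ ∈ GL_n(ℤ_p)`, `m : ι → ℤ`. -/
theorem exists_cartan_p (g : GL ι ℚ_[p]) :
    ∃ k₁ ∈ (Matrix.GeneralLinearGroup.map (n := ι) (algebraMap ℤ_[p] ℚ_[p])).range,
      ∃ k₂ ∈ (Matrix.GeneralLinearGroup.map (n := ι) (algebraMap ℤ_[p] ℚ_[p])).range,
        ∃ m : ι → ℤ, (g : Matrix ι ι ℚ_[p]) =
          (k₁ : Matrix ι ι ℚ_[p]) * diagonal (fun i => (p : ℚ_[p]) ^ m i) *
            (k₂ : Matrix ι ι ℚ_[p]) := by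
  obtain ⟨k₁, hk₁, k₂, hk₂, m, hg⟩ :=
    T5CartanUniformiser.exists_cartan_uniformiser (R := ℤ_[p]) PadicInt.irreducible_p g
  refine ⟨k₁, hk₁, k₂, hk₂, m, ?_⟩
  rw [hg, map_natCast]

/-- **`H(GL_n(ℚ_p), GL_n(ℤ_p))` is commutative** — no hypothesis. -/
theorem heckeAlgebra_mul_comm (k : Type*) [Field k]
    (T S : T5HeckePermutationModule.heckeAlgebra k
      (Matrix.GeneralLinearGroup.map (n := ι) (algebraMap ℤ_[p] ℚ_[p])).range) :
    T * S = S * T :=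
  haveI := finite_residueField_padicInt p
  T5DvrFiniteQuotients.heckeAlgebra_mul_comm k T S

/-- Spherical multiplicity one for `GL_n(ℚ_p)`, `K = GL_n(ℤ_p)`. -/
theorem finrank_invariants_eq_one {k : Type*} [Field k] [CharZero k] [IsAlgClosed k]
    {V : Type*} [AddCommGroup V] [Module k V] (ρ : Representation k (GL ι ℚ_[p]) V)
    [ρ.IsIrreducible]
    (hK : T5LevelIdempotent.KFinite ρ
      (Matrix.GeneralLinearGroup.map (n := ι) (algebraMap ℤ_[p] ℚ_[p])).range)
    [FiniteDimensional k (LevelPositivity.invariants ρ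
      (Matrix.GeneralLinearGroup.map (n := ι) (algebraMap ℤ_[p] ℚ_[p])).range)]
    (hne : LevelPositivity.invariants ρ
      (Matrix.GeneralLinearGroup.map (n := ι) (algebraMap ℤ_[p] ℚ_[p])).range ≠ ⊥) :
    Module.finrank k (LevelPositivity.invariants ρ
      (Matrix.GeneralLinearGroup.map (n := ι) (algebraMap ℤ_[p] ℚ_[p])).range) = 1 :=
  haveI := finite_residueField_padicInt p
  T5SphericalMultiplicityOneGLn.finrank_invariants_eq_one ρ hK hne

end Summit.Ventures.HodgeRepro2.T5PadicHeckeCommutative
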